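import Summits.ResolutionOfSingularities.ResolutionOfSingularities.Theorems.LossEntryW20
import HarnessLib

/-!
# LossEntryW21 (= lens-3 g29 slice 13) — walk plumbing of the loss→entry law — READING INDEPENDENCE c ↔ a; (S4) with b_v(b) = 0

decomp-res-lens-3, gen 29 (NODE-g29 §3ter).  TOOL at 0.  Imports `Theorems.LossEntryW20`.

§33 — READING INDEPENDENCE `c ↔ a` OF THE ENTRY VERTEX AND (S4) WITH `b_v(b) = 0` (NODE-g29 §3ter (S4)): **`vertexOf_entryPts_swapShear`**
(for `ν g = 1`, `ν, g ≠ 0`, any `G` with cleaned degrees `≥ o`: `entryPts s o b a (clean G)` and `entryPts s o b c (clean (swapShear a c ν g G))` have the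
same lex-min vertex — `exists_dom_swapShear` with the ORDINATE letter fixed, fed into `vertexOf_entryPts_eq_of_dom`), and
**`betaOf_polyPts_succ_ceiling_le_of_b_zero`**: at a straight one-wall state whose move is in the chart of the CEILING letter `c` (`b_v(a) ≠ 0`,
`b_v(b) = 0`), `ŷ(polyPts s r_{v+1} c b a F_{v+1}) ≤ ŷ(polyPts s r_v a b c F_v)` — the chart-`c` reading equals the fictitious chart-`a` reading of the
same centre (`swapShear_shear`), whose ordinate the PURE α-law `betaOf_polyPts_alphaStep_le` bounds; no legality / layer hypothesis on the new state.
-/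

open MvPolynomial Finset
open Literature.AlgebraicGeometry.Resolution
open Literature.AlgebraicGeometry.Resolution.Hauser2010
open Literature.AlgebraicGeometry.Resolution.PointBlowup
open Summit.ResolutionOfSingularities.ResolutionOfSingularities.Theorems.TightDefectClasses
open Summit.ResolutionOfSingularities.ResolutionOfSingularities.Theorems.TightDefectStrongWalks
open Summit.ResolutionOfSingularities.ResolutionOfSingularities.Theorems.ItineraryCutClasses
open Summit.ResolutionOfSingularities.ResolutionOfSingularities.Theorems.BoundaryLedger
open Summit.ResolutionOfSingularities.ResolutionOfSingularities.Theorems.ProximityCut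
open Summit.ResolutionOfSingularities.ResolutionOfSingularities.Theorems.LossExitCone
open Summit.ResolutionOfSingularities.ResolutionOfSingularities.Theorems.LossPolygon

/-! ## §33 READING INDEPENDENCE `c ↔ a` AND THE CEILING-CHART β-STEP WITH `b_v(b) = 0` (NODE-g29 §3ter (S4), first sub-case) -/

namespace Summit.ResolutionOfSingularities.ResolutionOfSingularities.Theorems.LossPolygon

variable {K : Type} [Field K] {q : ℕ}

section SwapEntry

variable {a b c : Fin 3}

/-- **READING INDEPENDENCE OF THE ENTRY VERTEX UNDER `swapShear` (PROVED; NODE-g29 §3ter (S4)).**  For `ν g = 1`, `ν, g ≠ 0` and ANY `G`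
with all cleaned degrees `≥ o`: the entry set of `clean G` in the frame `(· ; b, a)` (ordinate letter `b`, ceiling `a`) and the entry set of
`clean (swapShear a c ν g G)` in the frame `(· ; b, c)` have THE SAME LEX-MIN VERTEX — the two-sided line domination
`exists_dom_swapShear` (fixed letter `b`; partners with the same `b`-exponent and degree and no larger ceiling exponent) fed into
`vertexOf_entryPts_eq_of_dom`.  This is the `h21` block of slice 3 made into a lemma, for the fixed letter = the ORDINATE letter. [new] -/
theorem vertexOf_entryPts_swapShear (hab : a ≠ b) (hac : a ≠ c) (hbc : b ≠ c) {ν g : K} (hν : ν ≠ 0) (hg : g ≠ 0)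
    (hνg : ν * g = 1) (hLucas : ∀ D T : ℕ, q ∣ D → ¬ q ∣ T → ((D.choose T : ℕ) : K) = 0) {s o : ℕ}
    (G : MvPolynomial (Fin 3) K) (ho : ∀ E ∈ (deletePthPowers q G).support, o ≤ E.degree)
    (hne : (entryPts s o b a (deletePthPowers q G)).Nonempty) :
    (entryPts s o b c (deletePthPowers q (swapShear a c ν g G))).Nonempty ∧
      vertexOf (entryPts s o b a (deletePthPowers q G)) =
        vertexOf (entryPts s o b c (deletePthPowers q (swapShear a c ν g G))) := by
  classical
  have hback : swapShear c a g ν (swapShear a c ν g G) = G := swapShear_swapShear hab.symm hbc hac hνg G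
  refine vertexOf_entryPts_eq_of_dom (s := s) (o := o) (a := b) (c := a) (a' := b) (c' := c)
    (G := deletePthPowers q G) (G' := deletePthPowers q (swapShear a c ν g G))
    (fun E hE hEa => ?_) (fun E' hE' hE'c => ?_) hne
  · obtain ⟨E', hE', hE'b, hE'deg, hE'c⟩ := exists_dom_swapShear hab.symm hbc hac hν hg hLucas G hE
    exact ⟨E', hE', lt_of_le_of_lt hE'c hEa, toLex_entryPt_le hE'deg (ho E hE) hE'b.le hE'c hEa⟩
  · obtain ⟨E, hE, hEb, hEdeg, hEa⟩ :=
      exists_dom_swapShear hbc hab.symm (Ne.symm hac) hg hν hLucas (swapShear a c ν g G) hE'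
    rw [hback] at hE
    have hoE' : o ≤ E'.degree := by rw [← hEdeg]; exact ho E hE
    exact ⟨E, hE, lt_of_le_of_lt hEa hE'c, toLex_entryPt_le hEdeg hoE' hEb.le hEa hE'c⟩

end SwapEntry

section CeilingStepWalk

variable [DecidableEq K] {s₀ : State (Fin 3) K}

/-- **(S4), FIRST SUB-CASE — THE CEILING-CHART β-STEP WITH `b_v(b) = 0` DOES NOT RAISE THE ORDINATE (PROVED; NODE-g29 §3ter (S4)).**
At a straight one-wall state `v` (`r_v = M e_a`, all degrees `≥ M + s`, frame `(a ; b, c)`) whose move is in the chart of the CEILING letter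
`c` with `b_v(a) ≠ 0`, `b_v(b) = 0`, leaving the one-wall state `r_{v+1} = M′ e_c`, `q + M′ = M + s`:
`ŷ(polyPts s r_{v+1} c b a F_{v+1}) ≤ ŷ(polyPts s r_v a b c F_v)` (new frame `(c ; b, a)`).  Proof = READING INDEPENDENCE: the move is
`F_{v+1} = clean(chart_c(σ_{a,c,g_a} F_v))` (`st_succ_F_two_shears`, `shear_zero`), its polygon is the entry set `entryPts s (M+s) b a` of
`clean(σ_{a,c,g_a} F_v)` (`polyPts_deletePthPowers_chartTransform_eq_entryPts`); `swapShear a c g_a g_a⁻¹ (σ_{a,c,g_a} F_v) = σ_{c,a,g_a⁻¹} F_v`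
(`swapShear_shear`) is the prepared equation of the SAME centre read in the chart `a` (the α-move `(1 : 0 : g_a⁻¹)`), whose entry set
`entryPts s (M+s) b c` is the frame-`(a ; b, c)` polygon of `clean(chart_a(σ_{c,a,g_a⁻¹} F_v))` with walls `M′ e_a`; the two entry sets have the
same vertex (`vertexOf_entryPts_swapShear`), and the PURE α-LAW `betaOf_polyPts_alphaStep_le` (no walk, any shear parameters, no legality
hypothesis on the output) bounds the latter's ordinate by `ŷ(P_v)`.  Both wall polygons are assumed non-empty and the source has `x̂ < 1`
(walk facts at heavy states). [new] -/
theorem betaOf_polyPts_succ_ceiling_le_of_b_zero (hs : IsRoot q s₀) (W : ForcedWalk q s₀) (v : ℕ) {a b c : Fin 3}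
    (hab : a ≠ b) (hac : a ≠ c) (hbc : b ≠ c) (hj : W.j v = c)
    (hLucas : ∀ D T : ℕ, q ∣ D → ¬ q ∣ T → ((D.choose T : ℕ) : K) = 0) {s M M' : ℕ} (hoM : q + M' = M + s)
    (hord : ∀ D ∈ (W.st v).F.support, M + s ≤ D.degree)
    (hrva : (W.st v).r a = M) (hrvb : (W.st v).r b = 0) (hrvc : (W.st v).r c = 0)
    (hr₁c : (W.st (v + 1)).r c = M') (hr₁a : (W.st (v + 1)).r a = 0) (hr₁b : (W.st (v + 1)).r b = 0)
    (hga : W.b v a ≠ 0) (hgb : W.b v b = 0)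
    (hne : (polyPts s (W.st v).r a b c (W.st v).F).Nonempty) (hα : alphaOf (polyPts s (W.st v).r a b c (W.st v).F) < 1)
    (hne₁ : (polyPts s (W.st (v + 1)).r c b a (W.st (v + 1)).F).Nonempty) :
    betaOf (polyPts s (W.st (v + 1)).r c b a (W.st (v + 1)).F) ≤ betaOf (polyPts s (W.st v).r a b c (W.st v).F) := by
  classical
  have hνg : W.b v a * (W.b v a)⁻¹ = 1 := mul_inv_cancel₀ hga
  have hgi : (W.b v a)⁻¹ ≠ 0 := inv_ne_zero hga
  -- the move, with the vanishing `b`-translation removed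
  have hF : (W.st (v + 1)).F = deletePthPowers q (chartTransform q c (shear a c (W.b v a) (W.st v).F)) := by
    rw [st_succ_F_two_shears hs W v hac hbc hab hj, hgb, shear_zero]
  -- degrees of the two prepared equations
  have hordS : ∀ E ∈ (shear a c (W.b v a) (W.st v).F).support, M + s ≤ E.degree := fun E hE => by
    obtain ⟨D₀, hD₀, hdeg⟩ := exists_degree_eq_of_mem_support_shear a c (W.b v a) _ hE
    rw [hdeg]; exact hord D₀ hD₀
  have hordY : ∀ E ∈ (shear c a (W.b v a)⁻¹ (W.st v).F).support, M + s ≤ E.degree := fun E hE => by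
    obtain ⟨D₀, hD₀, hdeg⟩ := exists_degree_eq_of_mem_support_shear c a (W.b v a)⁻¹ _ hE
    rw [hdeg]; exact hord D₀ hD₀
  have ho' : ∀ E ∈ (deletePthPowers q (shear a c (W.b v a) (W.st v).F)).support, M + s ≤ E.degree := fun E hE => by
    rw [support_deletePthPowers', Finset.mem_filter] at hE; exact hordS E hE.1
  -- the target polygon is an entry set
  have hT : polyPts s (W.st (v + 1)).r c b a (W.st (v + 1)).F =
      entryPts s (M + s) b a (deletePthPowers q (shear a c (W.b v a) (W.st v).F)) := by
    rw [hF]; exact polyPts_deletePthPowers_chartTransform_eq_entryPts hbc (Ne.symm hac) hoM hr₁c hr₁b hr₁a hordS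
  -- the fictitious α-reading of the same centre
  have hY : swapShear a c (W.b v a) (W.b v a)⁻¹ (shear a c (W.b v a) (W.st v).F) = shear c a (W.b v a)⁻¹ (W.st v).F :=
    swapShear_shear hac hνg _
  set r' : Fin 3 →₀ ℕ := Finsupp.single a M' with hr'
  have hr'a : r' a = M' := by rw [hr', Finsupp.single_apply, if_pos rfl]
  have hr'b : r' b = 0 := by rw [hr', Finsupp.single_apply, if_neg hab]
  have hr'c : r' c = 0 := by rw [hr', Finsupp.single_apply, if_neg hac]
  have hA : polyPts s r' a b c (deletePthPowers q (chartTransform q a (shear c a (W.b v a)⁻¹ (W.st v).F))) =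
      entryPts s (M + s) b c (deletePthPowers q (shear c a (W.b v a)⁻¹ (W.st v).F)) :=
    polyPts_deletePthPowers_chartTransform_eq_entryPts hab.symm hac hoM hr'a hr'b hr'c hordY
  -- reading independence
  have hneT : (entryPts s (M + s) b a (deletePthPowers q (shear a c (W.b v a) (W.st v).F))).Nonempty := by
    rw [← hT]; exact hne₁
  have hRI := (vertexOf_entryPts_swapShear hab hac hbc hga hgi hνg hLucas (s := s) (o := M + s) _ ho' hneT).2
  rw [hY] at hRI
  -- the pure α-law for the fictitious reading
  have hrb' : r' b = (W.st v).r b := by rw [hr'b, hrvb]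
  have hra' : r' a + q = s + (W.st v).r a + (W.st v).r b := by rw [hr'a, hrva, hrvb]; omega
  have hlaw := betaOf_polyPts_alphaStep_le hab hac hbc hrb' hra' hrvc hr'c (W.b v a)⁻¹ 0
    (fun D hD => le_degree_of_mem_support hs W v hD) (fun D hD => walk_r hs W v D hD a)
    (fun D hD => not_isPthPowerExponent_of_mem_support hs W v hD) hne hα
  rw [shear_zero] at hlaw
  calc betaOf (polyPts s (W.st (v + 1)).r c b a (W.st (v + 1)).F)
      = betaOf (entryPts s (M + s) b a (deletePthPowers q (shear a c (W.b v a) (W.st v).F))) := by rw [hT]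
    _ = betaOf (entryPts s (M + s) b c (deletePthPowers q (shear c a (W.b v a)⁻¹ (W.st v).F))) := by
          unfold betaOf; rw [hRI]
    _ = betaOf (polyPts s r' a b c (deletePthPowers q (chartTransform q a (shear c a (W.b v a)⁻¹ (W.st v).F)))) := by
          rw [hA]
    _ ≤ betaOf (polyPts s (W.st v).r a b c (W.st v).F) := hlaw

end CeilingStepWalk

end Summit.ResolutionOfSingularities.ResolutionOfSingularities.Theorems.LossPolygon
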